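import Mathlib
import Summits.NavierStokesRegularity.NavierStokesRegularity.Theorems.EulerZoomLiouvillePowerGaugeEulerLiouvilleSelfSimilarGlobalTrajectory
import Summits.NavierStokesRegularity.NavierStokesRegularity.Theorems.EulerZoomLiouvillePowerGaugeEulerLiouvilleSelfSimilarBadNodeLoc
import Summits.NavierStokesRegularity.NavierStokesRegularity.Theorems.EulerZoomLiouvillePowerGaugeEulerLiouvilleSelfSimilarThinSetsLoc
import Summits.NavierStokesRegularity.NavierStokesRegularity.Theorems.EulerZoomLiouvillePowerGaugeEulerLiouvilleSelfSimilarRigidityC2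
import Summits.NavierStokesRegularity.NavierStokesRegularity.Theorems.EulerZoomLiouvillePowerGaugeEulerLiouvilleSelfSimilarLimitSetKill
import Literature.Analysis.FluidPDE.PineauVicolOneSliceVorticity
import HarnessLib.Audit

/-!
# Rung C1 of the crux `EulerZoomLiouville.PowerGaugeEulerLiouville` (W3a step L5): A BOUNDED `C²` SELF-SIMILAR EULER PROFILE IS
# CONSTANT — no gradient bound, no pressure hypothesis, no far field — and the classical stratum «V ∈ C² ∩ L^∞»

Route №10 `EulerZoomLiouville` (NavierStokesRegularity), crux E = stmt-NavierStokesRegularity-19832, tenure rung C1,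
registered residue `stub_selfSimilarExtremalRest`, sub-stratum W3a.  Lineage ns-typeII-p2 (gen 8, INTERIM LEAD).  CUTOFF
LOCALISATION (programme HOME/ns-typeII-p2/W3a-PLAN-19832.md): the three-lineage dynamical argument needs a global Lipschitz
constant only to have a flow API; but a bounded velocity confines every backward similarity orbit to a ball
(`C2.Kelvin.norm_flow_le_of_nonpos'`), so one may run the flow of a CUT-OFF field `Ṽ = χU` (globally Lipschitz, equal to `U` on
that ball) and feed the pointwise / trajectory-level profile facts of the TRUE profile `U` where the two agree:
p1's limit-set kill and the Bernoulli budget along the global `W_U`-curve through `x` (`…GlobalTrajectory`), the profile-free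
no-drift / bad-node / thin-node lemmas (`…NoDriftLoc`, `…BadNodeLoc`, `…ThinSetsLoc`) for the `Ṽ`-flow, ns-typeII-p3's block
data at non-vortical nodes (`exists_thinBlock_of_curl_eq_zero_of_bad` for `U`, transported by `DṼ(z) = DU(z)`), and the
profile-free null-basin cover `C2.Kelvin.volume_setOf_tendsto_flow_atBot_mem_eq_zero_of_trappedSets`.

* `exists_cutoff` — `U ∈ C²`, `‖U‖ ≤ M`, `R > 0` ⇒ a `C²` field `Ṽ` with `‖Ṽ‖ ≤ M`, `‖DṼ‖ ≤ K`, `Ṽ = U` on `ball 0 R`;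
* **`curl_eq_zero_of_bounded`** — `(U, P)` a self-similar Euler profile (CIV (3.3); so `U ∈ C²`), `‖U‖ ≤ M`, `0 < γ < ½` ⇒
  `curl U ≡ 0`; **`eq_const_of_bounded`** — hence `U` is CONSTANT;
* **`selfSimilar_ae_eq_zero_of_boundedC2_profile`** — MEMBER LEVEL, crux hypotheses verbatim (`0 < ρ < 1`) + exact
  self-similarity: if the velocity profile is `C²` and BOUNDED, the member vanishes.  The classical stratum of the crux is
  «`V ∈ C² ∩ L^∞`» (skeleton v16): a self-similar blow-up in the class whose physical velocity is bounded in space and whose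
  profile has CIV's regularity does not exist.

WHAT THIS IS NOT: not NS, not E, not rung C1 — the weak class (`V ∉ C²`) and `C²` profiles with `V` UNBOUNDED at infinity
remain. [folklore; ChaeShvydkoy2013 §4 (setting); ConstantinIgnatovaVicol2026Putative §3 (setting)]
-/

noncomputable section

-- flat `Theorems/<Route><Decl>…` files of one crux share the namespace of the crux (tree convention)
set_option linter.dupNamespace false

open MeasureTheory Set Filter Topology Metric Function InnerProductSpace
open scoped RealInnerProductSpace NNReal ENNReal ContDiff

namespace Summit.NavierStokesRegularity.NavierStokesRegularity.Theorems.PowerGaugeEulerLiouville.Loc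

open Literature.Analysis Literature.Analysis.FluidPDE
open Summit.NavierStokesRegularity.NavierStokesRegularity.Theorems.PowerGaugeEulerLiouville.Kelvin

variable {γ : ℝ} {U : EuclideanSpace ℝ (Fin 3) → EuclideanSpace ℝ (Fin 3)} {P : EuclideanSpace ℝ (Fin 3) → ℝ}

/-! ### The cutoff -/

/-- **Cutoff**: a bounded `C²` field `U` (`‖U‖ ≤ M`) agrees on `ball 0 R` with a `C²` field `Ṽ = χ U` that is bounded by `M` and has
GLOBALLY bounded gradient (`χ` a smooth bump, `= 1` on `closedBall 0 R`, supported in `ball 0 (R+1)`). [folklore] -/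
theorem exists_cutoff (hU : ContDiff ℝ 2 U) {M : ℝ} (hM : ∀ y, ‖U y‖ ≤ M) {R : ℝ} (hR : 0 < R) :
    ∃ V : EuclideanSpace ℝ (Fin 3) → EuclideanSpace ℝ (Fin 3), ContDiff ℝ 2 V ∧ (∀ y, ‖V y‖ ≤ M) ∧
      (∃ K : ℝ, ∀ y, ‖fderiv ℝ V y‖ ≤ K) ∧ ∀ y ∈ ball (0 : EuclideanSpace ℝ (Fin 3)) R, V y = U y := by
  let χ : ContDiffBump (0 : EuclideanSpace ℝ (Fin 3)) := ⟨R, R + 1, hR, by linarith⟩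
  set V : EuclideanSpace ℝ (Fin 3) → EuclideanSpace ℝ (Fin 3) := fun y => χ y • U y with hVdef
  have hV : ContDiff ℝ 2 V := (χ.contDiff (n := 2)).smul hU
  refine ⟨V, hV, fun y => ?_, ?_, fun y hy => ?_⟩
  · rw [hVdef, norm_smul, Real.norm_of_nonneg χ.nonneg]
    calc χ y * ‖U y‖ ≤ 1 * ‖U y‖ := mul_le_mul_of_nonneg_right χ.le_one (norm_nonneg _)
      _ ≤ M := by rw [one_mul]; exact hM y
  · have hDVc : Continuous (fderiv ℝ V) := hV.continuous_fderiv (by norm_num)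
    obtain ⟨C, hC⟩ := (isCompact_closedBall (0 : EuclideanSpace ℝ (Fin 3)) (R + 2)).exists_bound_of_continuousOn
      hDVc.continuousOn
    refine ⟨max C 0, fun y => ?_⟩
    by_cases hy : ‖y‖ ≤ R + 2
    · exact (hC y (by rwa [mem_closedBall, dist_zero_right])).trans (le_max_left _ _)
    · push Not at hy
      have hzero : V =ᶠ[𝓝 y] fun _ => 0 := by
        have hopen : IsOpen {y' : EuclideanSpace ℝ (Fin 3) | R + 1 < ‖y'‖} := isOpen_lt continuous_const continuous_norm
        filter_upwards [hopen.mem_nhds (show R + 1 < ‖y‖ by linarith)] with y' hy'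
        have hns : y' ∉ Function.support (χ : EuclideanSpace ℝ (Fin 3) → ℝ) := by
          rw [χ.support_eq, mem_ball, dist_zero_right]
          exact not_lt.2 (le_of_lt hy')
        rw [Function.notMem_support] at hns
        simp [hVdef, hns]
      rw [hzero.fderiv_eq, fderiv_const_apply, norm_zero]
      exact le_max_right _ _
  · rw [mem_ball, dist_zero_right] at hy
    have h1 : χ y = 1 := χ.one_of_mem_closedBall (by rw [mem_closedBall, dist_zero_right]; exact hy.le)
    simp [hVdef, h1]

/-! ### A bounded `C²` profile is irrotational, hence constant -/

/-- **A BOUNDED `C²` SELF-SIMILAR EULER PROFILE IS IRROTATIONAL** (`0 < γ < ½`): `(U, P)` satisfies CIV (3.3) (so `U ∈ C²`) and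
`‖U‖ ≤ M` ⇒ `curl U x₀ = 0` for every `x₀`.  Cutoff localisation around the confinement ball of `ball x₀ 1` (see the module
docstring). [folklore; three-lineage chain of the ns-regularity-ideate cell, localised] -/
theorem curl_eq_zero_of_bounded (hprof : IsSelfSimilarEulerProfile γ 0 U P) {M : ℝ} (hM : ∀ y, ‖U y‖ ≤ M)
    (hγ : 0 < γ) (hγ2 : γ < 1 / 2) (x₀ : EuclideanSpace ℝ (Fin 3)) : curl U x₀ = 0 := by
  have hU2 : ContDiff ℝ 2 U := hprof.contDiff_velocity
  have hU1 : ContDiff ℝ 1 U := hU2.of_le (by norm_num)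
  have hM0 : 0 ≤ M := (norm_nonneg _).trans (hM 0)
  set R₀ : ℝ := ‖x₀‖ + 1 + M / γ with hR₀def
  have hMγ : 0 ≤ M / γ := div_nonneg hM0 hγ.le
  have hR₀ : 0 < R₀ := by rw [hR₀def]; positivity
  -- the cutoff field
  obtain ⟨V, hV, hVM, ⟨K, hK⟩, hagree⟩ := exists_cutoff hU2 hM (R := R₀ + 1) (by linarith)
  have hV1 : ContDiff ℝ 1 V := hV.of_le (by norm_num)
  have hnear : ∀ z : EuclideanSpace ℝ (Fin 3), ‖z‖ ≤ R₀ → V =ᶠ[𝓝 z] U := by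
    intro z hz
    have hmem : ball (0 : EuclideanSpace ℝ (Fin 3)) (R₀ + 1) ∈ 𝓝 z :=
      isOpen_ball.mem_nhds (by rw [mem_ball, dist_zero_right]; linarith)
    exact Filter.eventually_of_mem hmem fun y hy => hagree y hy
  have hDeq : ∀ z : EuclideanSpace ℝ (Fin 3), ‖z‖ ≤ R₀ → fderiv ℝ V z = fderiv ℝ U z :=
    fun z hz => (hnear z hz).fderiv_eq
  have hcurlEq : ∀ z : EuclideanSpace ℝ (Fin 3), ‖z‖ ≤ R₀ → curl V z = curl U z :=
    fun z hz => curl_congr_fderiv (hDeq z hz)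
  have hWeq : ∀ z : EuclideanSpace ℝ (Fin 3), ‖z‖ < R₀ + 1 →
      selfSimilarTransport γ 0 V z = selfSimilarTransport γ 0 U z := by
    intro z hz
    simp only [selfSimilarTransport_apply, hagree z (by rwa [mem_ball, dist_zero_right])]
  set Φ := ODE.evolutionMap (fun _ : ℝ => selfSimilarTransport γ 0 V) 0 with hΦ
  -- the bad set of `V` inside the closed ball `R₀`
  set B : Set (EuclideanSpace ℝ (Fin 3)) := {z | z ∈ selfSimilarNodalSet γ 0 V ∧ ‖z‖ ≤ R₀ ∧
    ∃ w : EuclideanSpace ℝ (Fin 3), ‖w‖ = 1 ∧ 1 ≤ ⟪fderiv ℝ V z w, w⟫} with hB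
  have hBc : IsCompact B := by
    have hWc : Continuous (selfSimilarTransport γ 0 V) := (contDiff_selfSimilarTransport (γ := γ) hV).continuous
    have h1 : IsClosed (selfSimilarNodalSet γ 0 V) := isClosed_eq hWc continuous_const
    have h2 : IsClosed {z : EuclideanSpace ℝ (Fin 3) | ‖z‖ ≤ R₀} := isClosed_le continuous_norm continuous_const
    have h3 := isClosed_badSet_of_contDiff hV1
    have hcl : IsClosed B := by
      rw [hB, setOf_and, setOf_and]
      exact h1.inter (h2.inter h3)
    refine (isCompact_closedBall (0 : EuclideanSpace ℝ (Fin 3)) R₀).of_isClosed_subset hcl fun z hz => ?_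
    rw [mem_closedBall, dist_zero_right]; exact hz.2.1
  -- every point of `B` is thin for the `V`-flow
  have hthin : ∀ z ∈ B, ∃ T : ℝ, 0 < T ∧ ∃ r : ℝ, 0 < r ∧ volume {q : EuclideanSpace ℝ (Fin 3) |
      ∃ qs : ℕ → EuclideanSpace ℝ (Fin 3), qs 0 = q ∧ (∀ k, Φ T (qs (k + 1)) = qs k) ∧ ∀ k, qs k ∈ ball z r} = 0 := by
    rintro z ⟨hzN, hzR, hbad⟩
    by_cases hc : curl V z = 0
    · -- non-vortical: block data from the true profile `U`, transported by `DV z = DU z`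
      have hcU : curl U z = 0 := by rwa [hcurlEq z hzR] at hc
      have hbadU : ∃ w : EuclideanSpace ℝ (Fin 3), ‖w‖ = 1 ∧ 1 ≤ ⟪fderiv ℝ U z w, w⟫ := by
        rw [← hDeq z hzR]; exact hbad
      obtain ⟨b, lam, β, hA0, hA1, hA2, hshape⟩ :=
        exists_thinBlock_of_curl_eq_zero_of_bad (hU1.differentiable one_ne_zero) hprof.divFree hγ2 hcU hbadU
      rw [← hDeq z hzR] at hA0 hA1 hA2
      rcases hshape with ⟨h2, h20, h21⟩ | ⟨h0, h1, h02, h12⟩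
      · exact C2.Kelvin.exists_trappedSet_null_of_dominatedBlock hV hK hzN b lam β hA0 hA1 hA2 h2 h20 h21
      · exact C2.Kelvin.exists_trappedSet_null_of_contractingPlane hV hK hzN b lam β hA0 hA1 hA2 h0 h1 h02 h12
    · -- vortical: pointwise profile facts from `U`
      have hzNU : z ∈ selfSimilarNodalSet γ 0 U := by
        rw [mem_selfSimilarNodalSet_iff] at hzN ⊢
        have := hWeq z (by linarith)
        simp only [selfSimilarTransport_apply] at this
        rwa [this] at hzN
      have heig : fderiv ℝ V z (curl V z) = curl V z := by
        rw [hDeq z hzR, hcurlEq z hzR]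
        exact hprof.isSelfSimilarEulerVorticityProfile.fderiv_apply_curl_eq_of_mem_nodalSet hzNU
      have hdivz : LinearMap.trace ℝ _ ((fderiv ℝ V z : EuclideanSpace ℝ (Fin 3) →L[ℝ] EuclideanSpace ℝ (Fin 3)) :
          EuclideanSpace ℝ (Fin 3) →ₗ[ℝ] EuclideanSpace ℝ (Fin 3)) = 0 := by
        rw [hDeq z hzR]; exact hprof.divFree z
      exact exists_trappedSet_null_of_curl_ne_zero_loc hV hK (by linarith) hγ2 hzN hc heig hdivz
  have hnull := C2.Kelvin.volume_setOf_tendsto_flow_atBot_mem_eq_zero_of_trappedSets hV hK hBc hthin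
  -- every vortical point near `x₀` flows backward into `B`
  have hsub : {x : EuclideanSpace ℝ (Fin 3) | dist x x₀ < 1 ∧ curl U x ≠ 0} ⊆
      {x : EuclideanSpace ℝ (Fin 3) | ∃ z ∈ B, Tendsto (fun s => Φ s x) atBot (𝓝 z)} := by
    rintro x ⟨hx, hcx⟩
    have hxn : ‖x‖ ≤ ‖x₀‖ + 1 := by
      have := norm_le_norm_add_norm_sub' x x₀
      rw [← dist_eq_norm] at this
      linarith
    have hxR : ‖x‖ + M / γ ≤ R₀ := by rw [hR₀def]; linarith
    -- the backward half-orbit and its confinement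
    set Yp : ℝ → EuclideanSpace ℝ (Fin 3) := fun t => Φ (-t) x with hYp
    have hYpV : ∀ t, HasDerivAt Yp ((-1 : ℝ) • selfSimilarTransport γ 0 V (Yp t)) t :=
      fun t => C2.Kelvin.hasDerivAt_flow_neg (γ := γ) hV1 hK x t
    have hconf : ∀ t, 0 ≤ t → ‖Yp t‖ ≤ ‖x‖ + M / γ :=
      fun t ht => C2.Kelvin.norm_flow_le_of_nonpos' hV1 hK hVM hγ x (by linarith)
    have hYpU : ∀ t, 0 ≤ t → HasDerivAt Yp ((-1 : ℝ) • selfSimilarTransport γ 0 U (Yp t)) t := by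
      intro t ht
      have h := hYpV t
      rwa [hWeq (Yp t) (by linarith [hconf t ht])] at h
    -- a global `W_U`-curve extending it
    have hWU1 : ContDiff ℝ 1 (selfSimilarTransport γ 0 U) := contDiff_selfSimilarTransport (γ := γ) hU1
    have hgrowth : ∀ y, ‖selfSimilarTransport γ 0 U y‖ ≤ γ * ‖y‖ + M := by
      intro y
      rw [selfSimilarTransport_apply, sub_zero]
      calc ‖γ • y + U y‖ ≤ ‖γ • y‖ + ‖U y‖ := norm_add_le _ _
        _ ≤ γ * ‖y‖ + M := by rw [norm_smul, Real.norm_of_nonneg hγ.le]; exact add_le_add le_rfl (hM y)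
    obtain ⟨Y, hYeq, hY⟩ := exists_hasDerivAt_extension_of_linearGrowth hWU1 hγ.le hM0 hgrowth hYpU
    have hBd : ∀ t, 0 ≤ t → ‖Y t‖ ≤ R₀ := fun t ht => by rw [hYeq t ht]; exact (hconf t ht).trans hxR
    have hY0 : Y 0 = x := by
      rw [hYeq 0 le_rfl, hYp]
      simp only [neg_zero, hΦ, ODE.evolutionMap_self]
    have hx0 : curl U (Y 0) ≠ 0 := by rw [hY0]; exact hcx
    -- ns-typeII-p1's limit-set kill on the `U`-curve
    obtain ⟨z', hz'N, hz'R, hcl', w, hw, hbadw⟩ :=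
      NodalContinuum.exists_mapClusterPt_stretching_ge_one hprof (ne_of_lt hγ2) hY hBd hx0
    -- transfer to the `V`-orbit
    have hEq : Y =ᶠ[atTop] Yp := (eventually_ge_atTop (0 : ℝ)).mono fun t ht => hYeq t ht
    have hclYp : MapClusterPt z' atTop Yp := by
      have hmap : map Y atTop = map Yp atTop := Filter.map_congr hEq
      unfold MapClusterPt at hcl' ⊢
      rwa [hmap] at hcl'
    have hcl : MapClusterPt z' atBot (fun s => Φ s x) := by
      have e : Yp = (fun s => Φ s x) ∘ Neg.neg := rfl
      rw [e, mapClusterPt_comp, Filter.map_neg_atTop] at hclYp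
      exact hclYp
    -- point hypotheses from the profile along the `U`-curve
    have hWeqt : ∀ t, 0 ≤ t → selfSimilarTransport γ 0 U (Y t) = selfSimilarTransport γ 0 V (Yp t) := by
      intro t ht
      rw [hYeq t ht, hWeq (Yp t) (by linarith [hconf t ht])]
    have htendsU := hprof.tendsto_transport_comp_of_bounded (ne_of_lt hγ2) (σ := -1) (by norm_num) hY hBd
    have htendsYp : Tendsto (fun t => selfSimilarTransport γ 0 V (Yp t)) atTop (𝓝 0) :=
      htendsU.congr' ((eventually_ge_atTop (0 : ℝ)).mono fun t ht => hWeqt t ht)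
    have htends : Tendsto (fun s => selfSimilarTransport γ 0 V (Φ s x)) atBot (𝓝 0) := by
      have h := htendsYp.comp tendsto_neg_atBot_atTop
      refine h.congr fun s => ?_
      simp only [Function.comp_apply, hYp, neg_neg]
    obtain ⟨C, hC⟩ := hprof.exists_integral_norm_transport_sq_le (ne_of_lt hγ2) (σ := -1) (by norm_num) hY hBd
    have hcont : Continuous fun t : ℝ => ‖selfSimilarTransport γ 0 V (Φ (-t) x)‖ ^ 2 :=
      ((((contDiff_selfSimilarTransport (γ := γ) hV).continuous.comp
        ((C2.Kelvin.continuous_flow_apply (γ := γ) hV1 hK x).comp continuous_neg)).norm).pow 2)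
    have hint : IntegrableOn (fun t : ℝ => ‖selfSimilarTransport γ 0 V (Φ (-t) x)‖ ^ 2) (Ioi 0) := by
      refine integrableOn_Ioi_of_intervalIntegral_norm_bounded C 0 (l := atTop) (b := fun n : ℕ => (n : ℝ))
        (fun n => (hcont.integrableOn_Icc).mono_set Ioc_subset_Icc_self) tendsto_natCast_atTop_atTop ?_
      refine Eventually.of_forall fun n => ?_
      have h := hC 0 n le_rfl (Nat.cast_nonneg n)
      refine le_trans (le_of_eq ?_) h
      refine intervalIntegral.integral_congr fun t ht => ?_
      rw [uIcc_of_le (Nat.cast_nonneg n)] at ht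
      simp only [Real.norm_eq_abs, abs_pow, abs_norm]
      rw [hWeqt t ht.1]
    -- node facts at `z'`
    have hDz : fderiv ℝ V z' = fderiv ℝ U z' := hDeq z' hz'R
    have hz'NV : z' ∈ selfSimilarNodalSet γ 0 V := by
      rw [mem_selfSimilarNodalSet_iff] at hz'N ⊢
      have := hWeq z' (by linarith)
      simp only [selfSimilarTransport_apply] at this
      rwa [← this] at hz'N
    have hdiv0 : LinearMap.trace ℝ _ ((fderiv ℝ V z' : EuclideanSpace ℝ (Fin 3) →L[ℝ] EuclideanSpace ℝ (Fin 3)) :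
        EuclideanSpace ℝ (Fin 3) →ₗ[ℝ] EuclideanSpace ℝ (Fin 3)) = 0 := by
      rw [hDz]; exact hprof.divFree z'
    have heig : curl V z' ≠ 0 → fderiv ℝ V z' (curl V z') = curl V z' := fun _ => by
      rw [hDz, hcurlEq z' hz'R]
      exact hprof.isSelfSimilarEulerVorticityProfile.fderiv_apply_curl_eq_of_mem_nodalSet hz'N
    have hbadV : 1 ≤ ⟪fderiv ℝ V z' w, w⟫ := by rw [hDz]; exact hbadw
    obtain ⟨z, hzN, hz⟩ := tendsto_flow_atBot_of_badClusterPt_loc hV hK hVM hγ hγ2 x htends hint hcl hdiv0 heig hw hbadV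
    have hzz' : z' = z := eq_of_nhds_neBot (hcl.clusterPt.mono hz)
    exact ⟨z, ⟨hzN, hzz' ▸ hz'R, w, hw, hzz' ▸ hbadV⟩, hz⟩
  -- an open null set is empty
  have hopen : IsOpen {x : EuclideanSpace ℝ (Fin 3) | dist x x₀ < 1 ∧ curl U x ≠ 0} := by
    have h1 : IsOpen {x : EuclideanSpace ℝ (Fin 3) | dist x x₀ < 1} := isOpen_lt (continuous_id.dist continuous_const) continuous_const
    exact h1.inter (isOpen_ne_fun (differentiable_curl_of_contDiff hU2).continuous continuous_const)
  have hzero : volume {x : EuclideanSpace ℝ (Fin 3) | dist x x₀ < 1 ∧ curl U x ≠ 0} = 0 := measure_mono_null hsub hnull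
  have hempty := (hopen.measure_eq_zero_iff volume).1 hzero
  by_contra hx₀
  have : x₀ ∈ ({x : EuclideanSpace ℝ (Fin 3) | dist x x₀ < 1 ∧ curl U x ≠ 0} : Set _) := ⟨by simp, hx₀⟩
  rw [hempty] at this
  exact this

/-- **RIGIDITY WITHOUT A GRADIENT BOUND: a bounded `C²` self-similar Euler profile is CONSTANT** (`0 < γ < ½`; no hypothesis on
the pressure, the gradient, the far field or the stagnation set). [folklore] -/
theorem eq_const_of_bounded (hprof : IsSelfSimilarEulerProfile γ 0 U P) {M : ℝ} (hM : ∀ y, ‖U y‖ ≤ M)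
    (hγ : 0 < γ) (hγ2 : γ < 1 / 2) (x y : EuclideanSpace ℝ (Fin 3)) : U x = U y :=
  NoDrift.eq_const_of_curl_eq_zero_of_bounded hprof.contDiff_velocity (curl_eq_zero_of_bounded hprof hM hγ hγ2)
    hprof.divFree hM x y

/-! ### Member level: the classical stratum «V ∈ C² ∩ L^∞» -/

/-- **THE CLASSICAL STRATUM OF `stub_selfSimilarExtremalRest` WITHOUT A GRADIENT BOUND, MEMBER LEVEL.**  Crux hypotheses verbatim
(`0 < ρ < 1`) + exact self-similarity with profile `(V, P)`: if `V ∈ C²` and `‖V‖ ≤ M`, then `u = 0` a.e. on `(−∞,0) × ℝ³`.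
Nothing on the pressure (CIV (3.3) for some `C¹` pressure is derived), nothing on `DV`, the far field or the stagnation set;
rigidity makes `V` constant and the `A`-gauge kills the constant. [folklore] -/
theorem selfSimilar_ae_eq_zero_of_boundedC2_profile {ρ : ℝ} (hρ : 0 < ρ) (hρ1 : ρ < 1)
    {u : ℝ → EuclideanSpace ℝ (Fin 3) → EuclideanSpace ℝ (Fin 3)} {p : ℝ → EuclideanSpace ℝ (Fin 3) → ℝ}
    {H : ℝ → EuclideanSpace ℝ (Fin 3) → EuclideanSpace ℝ (Fin 3) →L[ℝ] EuclideanSpace ℝ (Fin 3)} {c : ℝ≥0}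
    (hsw : IsSuitableWeakSolutionOn (slab (EuclideanSpace ℝ (Fin 3)) (Iio 0) isOpen_Iio) 0 0 u p)
    (hgauge : ∀ a : ℝ, 0 < a →
      ENNReal.ofReal (a ^ (2 * ρ)) * cknA a (0 : ℝ × EuclideanSpace ℝ (Fin 3)) u +
          ENNReal.ofReal (a ^ ρ) * cknE a (0 : ℝ × EuclideanSpace ℝ (Fin 3)) H +
        ENNReal.ofReal (a ^ (2 * ρ)) * cknD a (0 : ℝ × EuclideanSpace ℝ (Fin 3)) p ≤ (c : ℝ≥0∞))
    {V : EuclideanSpace ℝ (Fin 3) → EuclideanSpace ℝ (Fin 3)} {P : EuclideanSpace ℝ (Fin 3) → ℝ}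
    (hu : ∀ τ : ℝ, τ < 0 → u τ = selfSimilarCollapse (1 / (2 + ρ)) 0 V τ)
    (hp : ∀ τ : ℝ, τ < 0 → p τ = selfSimilarCollapsePressure (1 / (2 + ρ)) 0 P τ)
    (hV : ContDiff ℝ 2 V) {M : ℝ} (hM : ∀ y, ‖V y‖ ≤ M) :
    uncurry u =ᵐ[volume.restrict (Iio (0 : ℝ) ×ˢ (univ : Set (EuclideanSpace ℝ (Fin 3))))] 0 := by
  have h2ρ : (0 : ℝ) < 2 + ρ := by linarith
  have hγ : (0 : ℝ) < 1 / (2 + ρ) := one_div_pos.2 h2ρ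
  have hγ2 : 1 / (2 + ρ) < 1 / 2 := one_div_lt_one_div_of_lt two_pos (by linarith)
  have hA : ∀ a : ℝ, 0 < a → ENNReal.ofReal (a ^ (2 * ρ)) *
      cknA a (0 : ℝ × EuclideanSpace ℝ (Fin 3)) u ≤ (c : ℝ≥0∞) :=
    fun a ha => le_trans (le_trans le_self_add le_self_add) (hgauge a ha)
  have hD : ∀ a : ℝ, 0 < a → ENNReal.ofReal (a ^ (2 * ρ)) *
      cknD a (0 : ℝ × EuclideanSpace ℝ (Fin 3)) p ≤ (c : ℝ≥0∞) :=
    fun a ha => le_trans le_add_self (hgauge a ha)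
  have hpm : AEStronglyMeasurable (uncurry p)
      (volume.restrict (Iio (0 : ℝ) ×ˢ (univ : Set (EuclideanSpace ℝ (Fin 3))))) := by
    have := hsw.distributional.2.2.1.aestronglyMeasurable
    simpa [slab] using this
  have hPm := aestronglyMeasurable_pressureProfile hpm hp
  have hDprof := profile_pressure_weight_of_gaugeD hρ hρ1 hpm hp hD
  have hP1 : LocallyIntegrable P volume :=
    EnergySaturation.locallyIntegrable_pressure_of_weight hρ1 hPm
      (ENNReal.mul_ne_top ENNReal.ofReal_ne_top ENNReal.coe_ne_top) hDprof
  obtain ⟨P', hprof⟩ := WeakToClassical.exists_isSelfSimilarEulerProfile_of_contDiff hsw.distributional hu hp hV hP1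
  -- rigidity and the `A`-gauge
  have hconst := eq_const_of_bounded hprof hM hγ hγ2
  set a : EuclideanSpace ℝ (Fin 3) := V 0 with ha
  have hVa : V = fun _ => a := funext fun z => hconst z 0
  have hgrowth := profile_energy_growth_of_gaugeA hρ hu hA
  have ha0 : a = 0 := by
    refine NoDrift.eq_zero_of_const_of_lintegral_ball_le (C := (c : ℝ≥0∞)) ENNReal.coe_ne_top (θ := 1 - 2 * ρ)
      (by linarith) fun L hL => ?_
    have h := hgrowth L hL
    rw [hVa] at h
    exact h
  have hV0 : V = 0 := by rw [hVa, ha0]; rfl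
  exact selfSimilar_ae_eq_zero_of_profile_eq_zero u hu hV0

end Summit.NavierStokesRegularity.NavierStokesRegularity.Theorems.PowerGaugeEulerLiouville.Loc

end
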